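import Literature.Topology.PlanarFoliations.ChainLimit
import HarnessLib

/-!
# Compact leaves of a chain cross every transversal at a frontier point of the limit set

Topic: Topology / PlanarFoliations, sequel to `ChainLimit.lean` (the limit set `Dlim` of a
strictly decreasing chain of discs of compact leaves `K n`). Let `x₀ = e.symm (a, τ₀)` be a
point of a flow box `e` of the atlas with `ι x₀ ∈ frontier Dlim`. Then:

* `exists_side_not_mem_Dlim` (**proved**): **on one side of `τ₀`, the transversal
  `τ ↦ e.symm (a, τ)` has points off `Dlim` arbitrarily close to `x₀`** — otherwise a whole
  band of plaques around `x₀` would lie in the saturated closed set `ι ⁻¹' Dlim`, putting `ι x₀`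
  in the interior;
* `exists_leaf_crossing` (**proved**): **on that side, for every `ε > 0`, all the leaves `K n`
  with `n` large cross the transversal within `ε` of `τ₀`** — the transversal segment from `x₀`
  (in every disc) to a point off the disc of `K n` meets the frontier `ι (K n)` of that disc.

This is the "start crossing lemma" feeding the compact leaves of the chain into the walk fences
along the frontier graph.

All statements are [folklore].
-/

noncomputable section

open Set Filter Function
open _root_.Topology
open Literature.Topology.FourManifolds Literature.Topology.FourManifolds.Foliation

namespace Literature.Topology.PlanarFoliations

variable {X : Type*} [TopologicalSpace X] [T2Space X] [SecondCountableTopology X] {F : Foliation ℝ X} {ι : X → ℂ}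
variable (hbi : IsBiOriented F) (hι : IsOpenEmbedding ι) {K : ℕ → X} (hK : ∀ n, IsCompact (F.leaf (K n)))
  (hdec : ∀ n, discLeaf F ι (K (n + 1)) ⊂ discLeaf F ι (K n))

include hbi hι hK hdec in
/-- **One side of a transversal at a frontier point of the limit set has points off the limit set
arbitrarily close.** [folklore] -/
theorem exists_side_not_mem_Dlim {e : OpenPartialHomeomorph X (ℝ × ℝ)} (he : e ∈ F.atlas) {a τ₀ : ℝ}
    (hx₀ : ι (e.symm (a, τ₀)) ∈ frontier (Dlim ι F K)) :
    ∃ s : ℝ, (s = 1 ∨ s = -1) ∧ ∀ ε > 0, ∃ τ, 0 < s * (τ - τ₀) ∧ |τ - τ₀| < ε ∧ ι (e.symm (a, τ)) ∉ Dlim ι F K := by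
  by_contra H
  push Not at H
  obtain ⟨ε₁, hε₁, h₁⟩ := H 1 (Or.inl rfl)
  obtain ⟨ε₂, hε₂, h₂⟩ := H (-1) (Or.inr rfl)
  have hclosed : IsClosed (Dlim ι F K) := (isCompact_Dlim hbi hι hK).isClosed
  have hx₀D : ι (e.symm (a, τ₀)) ∈ Dlim ι F K := hclosed.frontier_subset hx₀
  -- all transversal points at heights within `ε` of `τ₀` are in `Dlim`
  set ε := min ε₁ ε₂ with hε
  have hεpos : 0 < ε := lt_min hε₁ hε₂
  have hvert : ∀ τ, |τ - τ₀| < ε → ι (e.symm (a, τ)) ∈ Dlim ι F K := by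
    intro τ hτ
    rcases lt_trichotomy τ τ₀ with hlt | heq | hgt
    · exact h₂ τ (by nlinarith) (hτ.trans_le (min_le_right _ _))
    · rw [heq]; exact hx₀D
    · exact h₁ τ (by nlinarith) (hτ.trans_le (min_le_left _ _))
  -- hence, by saturation, the whole band of plaques
  have htarget : ∀ p : ℝ × ℝ, p ∈ e.target := fun p ↦ by rw [F.target_eq e he]; exact mem_univ _
  have hband : ∀ y ∈ e.source, |(e y).2 - τ₀| < ε → ι y ∈ Dlim ι F K := by
    intro y hy hτ
    have hplaque : y ∈ plaque e (e y).2 := ⟨hy, rfl⟩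
    have hleaf : y ∈ F.leaf (e.symm (a, (e y).2)) := by
      have hsub : plaque e (e y).2 ⊆ F.leaf (e.symm (a, (e y).2)) :=
        F.plaque_subset_leaf_of_mem he (F.mem_leaf_self _) (F.symm_mem_plaque he a _)
      exact hsub hplaque
    exact isSaturated_preimage_Dlim hbi hι hK hdec _ (hvert _ hτ) hleaf
  -- an open neighbourhood of `x₀` inside `ι ⁻¹' Dlim`
  set U : Set X := e.source ∩ e ⁻¹' (univ ×ˢ Ioo (τ₀ - ε) (τ₀ + ε)) with hU
  have hUo : IsOpen U := e.isOpen_inter_preimage (isOpen_univ.prod isOpen_Ioo)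
  have hx₀U : e.symm (a, τ₀) ∈ U := by
    refine ⟨e.map_target (htarget _), ?_⟩
    show e (e.symm (a, τ₀)) ∈ univ ×ˢ Ioo (τ₀ - ε) (τ₀ + ε)
    rw [e.right_inv (htarget _)]
    exact ⟨mem_univ _, by constructor <;> linarith⟩
  have hUsub : ι '' U ⊆ Dlim ι F K := by
    rintro _ ⟨y, ⟨hy, hy2⟩, rfl⟩
    have h2 : (e y).2 ∈ Ioo (τ₀ - ε) (τ₀ + ε) := (mem_prod.1 hy2).2
    exact hband y hy (by rw [abs_lt]; constructor <;> linarith [h2.1, h2.2])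
  have hint : ι (e.symm (a, τ₀)) ∈ interior (Dlim ι F K) :=
    interior_mono hUsub (hι.isOpenMap.image_interior_subset U ⟨_, by rwa [hUo.interior_eq], rfl⟩)
  exact hx₀.2 hint

include hbi hι hK hdec in
/-- **The compact leaves of the chain cross the transversal near a frontier point**, on the side
given by `exists_side_not_mem_Dlim`, within any `ε`, for all large `n`. [folklore] -/
theorem exists_leaf_crossing {e : OpenPartialHomeomorph X (ℝ × ℝ)} (he : e ∈ F.atlas) {a τ₀ : ℝ}
    (hx₀ : ι (e.symm (a, τ₀)) ∈ frontier (Dlim ι F K)) :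
    ∃ s : ℝ, (s = 1 ∨ s = -1) ∧ ∀ ε > 0, ∃ N, ∀ n ≥ N, ∃ τ, 0 < s * (τ - τ₀) ∧ |τ - τ₀| < ε ∧ e.symm (a, τ) ∈ F.leaf (K n) := by
  obtain ⟨s, hs, hside⟩ := exists_side_not_mem_Dlim hbi hι hK hdec he hx₀
  have hclosed : IsClosed (Dlim ι F K) := (isCompact_Dlim hbi hι hK).isClosed
  have hx₀D : ι (e.symm (a, τ₀)) ∈ Dlim ι F K := hclosed.frontier_subset hx₀
  have htarget : ∀ p : ℝ × ℝ, p ∈ e.target := fun p ↦ by rw [F.target_eq e he]; exact mem_univ _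
  refine ⟨s, hs, fun ε hε ↦ ?_⟩
  obtain ⟨τ', hτ's, hτ'ε, hτ'D⟩ := hside ε hε
  -- `ι (e.symm (a, τ'))` is off the disc of `K n` for `n` large
  have hN : ∃ N, ι (e.symm (a, τ')) ∉ discLeaf F ι (K N) := by
    by_contra h
    push Not at h
    exact hτ'D (mem_iInter.2 h)
  obtain ⟨N, hN⟩ := hN
  refine ⟨N, fun n hn ↦ ?_⟩
  have hnD : ι (e.symm (a, τ')) ∉ discLeaf F ι (K n) := fun h ↦ hN (discLeaf_antitone hdec hn h)
  have hx₀n : ι (e.symm (a, τ₀)) ∈ discLeaf F ι (K n) := mem_iInter.1 hx₀D n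
  -- the transversal segment between them meets the frontier of the disc, the leaf `K n`
  set c : ℝ → ℂ := fun τ ↦ ι (e.symm (a, τ)) with hc
  have hcc : Continuous c := by
    refine hι.continuous.comp ?_
    have hsymm : Continuous fun τ : ℝ ↦ e.symm (a, τ) :=
      e.continuousOn_symm.comp_continuous (continuous_const.prodMk continuous_id) fun τ ↦ htarget _
    exact hsymm
  have hseg : IsPreconnected (c '' uIcc τ₀ τ') := isPreconnected_uIcc.image c hcc.continuousOn
  obtain ⟨w, ⟨τ, hτ, rfl⟩, hwfr⟩ := inter_frontier_nonempty_of_mem hseg (isClosed_discLeaf hbi hι (hK n))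
    ⟨τ₀, left_mem_uIcc, rfl⟩ hx₀n ⟨τ', right_mem_uIcc, rfl⟩ hnD
  rw [frontier_discLeaf hbi hι (hK n)] at hwfr
  obtain ⟨y, hy, hyτ⟩ := hwfr
  have hyeq : y = e.symm (a, τ) := hι.injective hyτ
  -- `τ ≠ τ₀`: the leaf `K n` misses `Dlim ∋ ι x₀`
  have hτne : τ ≠ τ₀ := by
    rintro rfl
    have hmem : ι (e.symm (a, τ)) ∈ ι '' F.leaf (K n) := ⟨y, hy, hyτ⟩
    exact (image_leaf_disjoint_Dlim hbi hι hK hdec n).le_bot ⟨hmem, hx₀D⟩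
  refine ⟨τ, ?_, ?_, hyeq ▸ hy⟩
  · -- `τ` is on the side of `τ'`
    rcases hs with rfl | rfl
    · have h0 : τ₀ < τ' := by linarith
      have : τ ∈ Icc τ₀ τ' := by rwa [uIcc_of_le h0.le] at hτ
      rcases eq_or_lt_of_le this.1 with h | h
      · exact absurd h.symm hτne
      · linarith
    · have h0 : τ' < τ₀ := by linarith
      have : τ ∈ Icc τ' τ₀ := by rwa [uIcc_of_ge h0.le] at hτ
      rcases eq_or_lt_of_le this.2 with h | h
      · exact absurd h hτne
      · linarith
  · -- and within `ε`
    have hτI : |τ - τ₀| ≤ |τ' - τ₀| := abs_sub_left_of_mem_uIcc hτ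
    exact hτI.trans_lt hτ'ε

end Literature.Topology.PlanarFoliations
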